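import Summits.NavierStokesRegularity.NavierStokesRegularity.Theorems.CoriolisHeadCounterRotatingLiouvilleCalculus
import Literature.Analysis.FluidPDE.EnstrophySplitting
import Literature.Analysis.FluidPDE.ConstantinFeffermanStretching
import HarnessLib

/-!
# CoriolisHeadFarFieldOscillation — crux `NoCoRotatingCore` (stmt-NavierStokesRegularity-22676), line `far_field_constancy` v2
# (skeleton 15c9a82ad206abb9), stub K1b `stub_farFieldLimit`: POINTWISE CONSEQUENCES OF THE PROFILE EQUATION + SHELL OSCILLATION

For a rotated Leray profile `−νΔU + aU + a(y·∇)U + (BU − (By·∇)U) + (U·∇)U + ∇P = 0` (tree calculus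
`CoriolisHead.gradient_pressure_eq_of_rotated`, `laplacian_pressure_eq_of_rotated`):
* `norm_gradient_add_le_of_rotated`: `‖∇P + (aU + BU)‖ ≤ 3ν‖D²U‖ + (a + ‖B‖)·|y|‖DU‖ + ‖U‖‖DU‖` — with the scale-natural decay
  K1a (`|y|‖DU‖ + |y|²‖D²U‖ ≤ ε` far out) the right side is `≤ (3ν + a + ‖B‖ + M)ε`: `∇P = −(aI+B)U + o(1)`;
* `abs_laplacian_le_of_rotated`: `|ΔP| = |tr (DU∘DU)| ≤ 3‖DU‖²` (so `|ΔP| ≤ 3ε²/|y|²` far out);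
* `norm_sub_le_of_shell` (geometry): if `‖DU(w)‖ ≤ η` for `|w| ≥ R/2`, then `‖U z − U z'‖ ≤ 12Rη` for all `z, z'` in the
  shell `R ≤ |·| ≤ 2R` (three segments through `±2R e₀`, `±2R e₁`, each with non-negative inner products, hence inside `|w| ≥ R/2`);
* `norm_le_inv_mul_norm_of_skew`: `a‖v‖ ≤ ‖av + Bv‖` for skew `B`, `a > 0` (coercivity of `aI + B`).

WHAT THIS IS NOT: elementary bookkeeping; nothing about `NoCoRotatingCore`, Pineau–Vicol's conjecture or NS regularity.
-/

noncomputable section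

open MeasureTheory Set Function Filter Topology Metric InnerProductSpace Real
open scoped RealInnerProductSpace Laplacian ContDiff

set_option linter.dupNamespace false

namespace Summit.NavierStokesRegularity.NavierStokesRegularity.Theorems.CoriolisHead

open Literature.Analysis.FluidPDE

/-! ## §1 Pointwise consequences of the profile equation -/

section Equation

variable {ν a : ℝ} {B : (EuclideanSpace ℝ (Fin 3)) →L[ℝ] (EuclideanSpace ℝ (Fin 3))} {U : (EuclideanSpace ℝ (Fin 3)) → (EuclideanSpace ℝ (Fin 3))} {P : (EuclideanSpace ℝ (Fin 3)) → ℝ}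

/-- `‖∇P + (aU + BU)‖ ≤ 3ν‖D²U‖ + (a + ‖B‖)|y|‖DU‖ + ‖U‖‖DU‖` (the profile equation solved for `∇P`; `‖ΔU‖ ≤ 3‖D²U‖`). -/
theorem norm_gradient_add_le_of_rotated (hν : 0 ≤ ν) (ha : 0 ≤ a) (hU : ContDiff ℝ 2 U)
    (heq : ∀ y, -(ν • (Δ U) y) + a • U y + a • fderiv ℝ U y y + (B (U y) - fderiv ℝ U y (B y)) +
      convect U U y + gradient P y = 0) (y : (EuclideanSpace ℝ (Fin 3))) :
    ‖gradient P y + (a • U y + B (U y))‖ ≤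
      3 * ν * ‖iteratedFDeriv ℝ 2 U y‖ + (a + ‖B‖) * (‖y‖ * ‖fderiv ℝ U y‖) + ‖U y‖ * ‖fderiv ℝ U y‖ := by
  have hg := gradient_pressure_eq_of_rotated heq y
  have hre : gradient P y + (a • U y + B (U y)) =
      ν • (Δ U) y - a • fderiv ℝ U y y + fderiv ℝ U y (B y) - convect U U y := by
    rw [hg]; abel
  rw [hre]
  have h1 : ‖ν • (Δ U) y‖ ≤ 3 * ν * ‖iteratedFDeriv ℝ 2 U y‖ := by
    rw [norm_smul, Real.norm_of_nonneg hν]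
    calc ν * ‖(Δ U) y‖ ≤ ν * (3 * ‖iteratedFDeriv ℝ 2 U y‖) :=
          mul_le_mul_of_nonneg_left (norm_laplacian_le_three_mul_norm_iteratedFDeriv_two hU y) hν
      _ = 3 * ν * ‖iteratedFDeriv ℝ 2 U y‖ := by ring
  have h2 : ‖a • fderiv ℝ U y y‖ ≤ a * (‖y‖ * ‖fderiv ℝ U y‖) := by
    rw [norm_smul, Real.norm_of_nonneg ha]
    refine mul_le_mul_of_nonneg_left ?_ ha
    rw [mul_comm]; exact ContinuousLinearMap.le_opNorm _ _
  have h3 : ‖fderiv ℝ U y (B y)‖ ≤ ‖B‖ * (‖y‖ * ‖fderiv ℝ U y‖) := by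
    calc ‖fderiv ℝ U y (B y)‖ ≤ ‖fderiv ℝ U y‖ * ‖B y‖ := ContinuousLinearMap.le_opNorm _ _
      _ ≤ ‖fderiv ℝ U y‖ * (‖B‖ * ‖y‖) := mul_le_mul_of_nonneg_left (B.le_opNorm y) (norm_nonneg _)
      _ = ‖B‖ * (‖y‖ * ‖fderiv ℝ U y‖) := by ring
  have h4 : ‖convect U U y‖ ≤ ‖U y‖ * ‖fderiv ℝ U y‖ := by
    rw [convect, mul_comm]; exact ContinuousLinearMap.le_opNorm _ _
  have T : ∀ p q r s : (EuclideanSpace ℝ (Fin 3)), ‖p - q + r - s‖ ≤ ‖p‖ + ‖q‖ + ‖r‖ + ‖s‖ := fun p q r s =>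
    calc ‖p - q + r - s‖ ≤ ‖p - q + r‖ + ‖s‖ := norm_sub_le _ _
      _ ≤ ‖p - q‖ + ‖r‖ + ‖s‖ := by gcongr; exact norm_add_le _ _
      _ ≤ ‖p‖ + ‖q‖ + ‖r‖ + ‖s‖ := by gcongr; exact norm_sub_le _ _
  have key := T (ν • (Δ U) y) (a • fderiv ℝ U y y) (fderiv ℝ U y (B y)) (convect U U y)
  have hexp : (a + ‖B‖) * (‖y‖ * ‖fderiv ℝ U y‖) =
      a * (‖y‖ * ‖fderiv ℝ U y‖) + ‖B‖ * (‖y‖ * ‖fderiv ℝ U y‖) := by ring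
  rw [hexp]
  linarith

/-- `|ΔP| ≤ 3‖DU‖²` for a rotated profile (pressure Poisson equation `ΔP = −tr(DU∘DU)`, `|tr L| ≤ 3‖L‖` on `ℝ³`). -/
theorem abs_laplacian_le_of_rotated (hU : ContDiff ℝ (⊤ : ℕ∞) U) (hP2 : ContDiff ℝ 2 P)
    (hdiv : VectorCalculus.IsDivFree U)
    (heq : ∀ y, -(ν • (Δ U) y) + a • U y + a • fderiv ℝ U y y + (B (U y) - fderiv ℝ U y (B y)) +
      convect U U y + gradient P y = 0) (y : (EuclideanSpace ℝ (Fin 3))) :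
    |(Δ P) y| ≤ 3 * ‖fderiv ℝ U y‖ ^ 2 := by
  have hU3 : ContDiff ℝ 3 U := hU.of_le (by norm_cast)
  rw [laplacian_pressure_eq_of_rotated hU3 hP2 hdiv heq y, abs_neg]
  calc |traceCLM ((fderiv ℝ U y).comp (fderiv ℝ U y))|
      ≤ 3 * ‖(fderiv ℝ U y).comp (fderiv ℝ U y)‖ := abs_traceCLM_le_three_mul_opNorm _
    _ ≤ 3 * (‖fderiv ℝ U y‖ * ‖fderiv ℝ U y‖) :=
        mul_le_mul_of_nonneg_left (ContinuousLinearMap.opNorm_comp_le _ _) (by norm_num)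
    _ = 3 * ‖fderiv ℝ U y‖ ^ 2 := by ring

/-- coercivity of `aI + B` for skew `B`: `a‖v‖ ≤ ‖av + Bv‖` (`⟪av + Bv, v⟫ = a‖v‖²`). -/
theorem mul_norm_le_norm_of_skew (hB : ∀ x, inner ℝ (B x) x = 0) (v : (EuclideanSpace ℝ (Fin 3))) :
    a * ‖v‖ ≤ ‖a • v + B v‖ := by
  have hinner : ⟪a • v + B v, v⟫ = a * ‖v‖ ^ 2 := by
    rw [inner_add_left, inner_smul_left, hB v, add_zero, real_inner_self_eq_norm_sq]
    simp
  by_cases hv : v = 0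
  · simp [hv]
  · have hvpos : 0 < ‖v‖ := norm_pos_iff.2 hv
    have hcs : a * ‖v‖ ^ 2 ≤ ‖a • v + B v‖ * ‖v‖ := by
      rw [← hinner]; exact real_inner_le_norm _ _
    nlinarith

end Equation

/-! ## §2 Oscillation of `U` on a dyadic shell -/

section Shell

variable {U : (EuclideanSpace ℝ (Fin 3)) → (EuclideanSpace ℝ (Fin 3))}

/-- a segment between two points of norm `≥ R` with non-negative inner product stays outside `B(0, R/2)`. -/
theorem half_le_norm_of_mem_segment {R : ℝ} (hR : 0 ≤ R) {z m : (EuclideanSpace ℝ (Fin 3))} (hz : R ≤ ‖z‖) (hm : R ≤ ‖m‖)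
    (hzm : 0 ≤ ⟪z, m⟫) {w : (EuclideanSpace ℝ (Fin 3))} (hw : w ∈ segment ℝ z m) : R / 2 ≤ ‖w‖ := by
  rw [segment_eq_image] at hw
  obtain ⟨t, ⟨ht0, ht1⟩, rfl⟩ := hw
  have hsq : (R / 2) ^ 2 ≤ ‖(1 - t) • z + t • m‖ ^ 2 := by
    have hexp : ‖(1 - t) • z + t • m‖ ^ 2 =
        (1 - t) ^ 2 * ‖z‖ ^ 2 + 2 * ((1 - t) * t) * ⟪z, m⟫ + t ^ 2 * ‖m‖ ^ 2 := by
      rw [norm_add_sq_real, norm_smul, norm_smul, inner_smul_left, inner_smul_right, Real.norm_eq_abs,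
        Real.norm_eq_abs, abs_of_nonneg (by linarith), abs_of_nonneg ht0]
      simp only [conj_trivial]
      ring
    rw [hexp]
    have h1 : R ^ 2 ≤ ‖z‖ ^ 2 := pow_le_pow_left₀ hR hz 2
    have h2 : R ^ 2 ≤ ‖m‖ ^ 2 := pow_le_pow_left₀ hR hm 2
    have h3 : 0 ≤ 2 * ((1 - t) * t) * ⟪z, m⟫ := by
      have : 0 ≤ (1 - t) * t := mul_nonneg (by linarith) ht0
      positivity
    have h4 : 1 / 2 ≤ (1 - t) ^ 2 + t ^ 2 := by nlinarith [sq_nonneg (2 * t - 1)]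
    nlinarith [mul_le_mul_of_nonneg_left h1 (sq_nonneg (1 - t)), mul_le_mul_of_nonneg_left h2 (sq_nonneg t)]
  exact le_of_pow_le_pow_left₀ two_ne_zero (norm_nonneg _) hsq

/-- mean value on such a segment: if `‖DU(w)‖ ≤ η` for `|w| ≥ R/2`, then `‖U m − U z‖ ≤ η ‖m − z‖`. -/
theorem norm_sub_le_of_segment {R η : ℝ} (hR : 0 ≤ R) (hU : Differentiable ℝ U)
    (hη : ∀ w : (EuclideanSpace ℝ (Fin 3)), R / 2 ≤ ‖w‖ → ‖fderiv ℝ U w‖ ≤ η) {z m : (EuclideanSpace ℝ (Fin 3))} (hz : R ≤ ‖z‖) (hm : R ≤ ‖m‖)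
    (hzm : 0 ≤ ⟪z, m⟫) : ‖U m - U z‖ ≤ η * ‖m - z‖ :=
  (convex_segment z m).norm_image_sub_le_of_norm_fderiv_le (fun w _ => hU w)
    (fun w hw => hη w (half_le_norm_of_mem_segment hR hz hm hzm hw))
    (left_mem_segment ℝ z m) (right_mem_segment ℝ z m)

/-- a signed pole `±2R bᵢ` on the `i`-th axis (`b` = the standard orthonormal basis) seen under a non-negative angle from `z`. -/
theorem exists_pole_inner_nonneg {R : ℝ} (hR : 0 ≤ R) (z : (EuclideanSpace ℝ (Fin 3))) (i : Fin 3) :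
    ∃ c : ℝ, ‖c • EuclideanSpace.basisFun (Fin 3) ℝ i‖ = 2 * R ∧ 0 ≤ ⟪z, c • EuclideanSpace.basisFun (Fin 3) ℝ i⟫ := by
  have hb : ‖EuclideanSpace.basisFun (Fin 3) ℝ i‖ = 1 := (EuclideanSpace.basisFun (Fin 3) ℝ).orthonormal.1 i
  by_cases hzi : 0 ≤ ⟪z, EuclideanSpace.basisFun (Fin 3) ℝ i⟫
  · refine ⟨2 * R, ?_, ?_⟩
    · rw [norm_smul, hb, mul_one, Real.norm_of_nonneg (by linarith)]
    · rw [inner_smul_right]; positivity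
  · rw [not_le] at hzi
    refine ⟨-(2 * R), ?_, ?_⟩
    · rw [norm_smul, hb, mul_one, norm_neg, Real.norm_of_nonneg (by linarith)]
    · rw [inner_smul_right]; nlinarith

/-- poles on different axes are orthogonal. -/
theorem inner_poles_eq_zero {i₁ i₂ : Fin 3} (hne : i₁ ≠ i₂) (c₁ c₂ : ℝ) :
    ⟪c₁ • EuclideanSpace.basisFun (Fin 3) ℝ i₁, c₂ • EuclideanSpace.basisFun (Fin 3) ℝ i₂⟫ = 0 := by
  rw [inner_smul_left, inner_smul_right, (EuclideanSpace.basisFun (Fin 3) ℝ).orthonormal.2 hne]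
  simp

/-- **Oscillation on a dyadic shell.**  If `U` is differentiable with `‖DU(w)‖ ≤ η` for `|w| ≥ R/2` (`R ≥ 0`), then
`‖U z − U z'‖ ≤ 12 R η` for all `z, z'` with `R ≤ |z|, |z'| ≤ 2R` (path `z → ±2Rb₀ → ±2Rb₁ → z'`, three segments of
length `≤ 4R`, each inside `|w| ≥ R/2`). -/
theorem norm_sub_le_of_shell {R η : ℝ} (hR : 0 ≤ R) (hη0 : 0 ≤ η) (hU : Differentiable ℝ U)
    (hη : ∀ w : (EuclideanSpace ℝ (Fin 3)), R / 2 ≤ ‖w‖ → ‖fderiv ℝ U w‖ ≤ η) {z z' : (EuclideanSpace ℝ (Fin 3))}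
    (hz : R ≤ ‖z‖) (hz2 : ‖z‖ ≤ 2 * R) (hz' : R ≤ ‖z'‖) (hz'2 : ‖z'‖ ≤ 2 * R) :
    ‖U z - U z'‖ ≤ 12 * R * η := by
  obtain ⟨c₁, hm₁, hzm₁⟩ := exists_pole_inner_nonneg hR z (0 : Fin 3)
  obtain ⟨c₂, hm₂, hzm₂⟩ := exists_pole_inner_nonneg hR z' (1 : Fin 3)
  set m₁ : (EuclideanSpace ℝ (Fin 3)) := c₁ • EuclideanSpace.basisFun (Fin 3) ℝ 0 with hm₁def
  set m₂ : (EuclideanSpace ℝ (Fin 3)) := c₂ • EuclideanSpace.basisFun (Fin 3) ℝ 1 with hm₂def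
  have h12 : ⟪m₁, m₂⟫ = 0 := inner_poles_eq_zero (by decide) c₁ c₂
  have hzm₂' : 0 ≤ ⟪m₂, z'⟫ := by rw [real_inner_comm]; exact hzm₂
  have hm₁R : R ≤ ‖m₁‖ := by rw [hm₁]; linarith
  have hm₂R : R ≤ ‖m₂‖ := by rw [hm₂]; linarith
  -- the three segments
  have s1 : ‖U m₁ - U z‖ ≤ η * ‖m₁ - z‖ := norm_sub_le_of_segment hR hU hη hz hm₁R hzm₁
  have s2 : ‖U m₂ - U m₁‖ ≤ η * ‖m₂ - m₁‖ := norm_sub_le_of_segment hR hU hη hm₁R hm₂R h12.ge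
  have s3 : ‖U z' - U m₂‖ ≤ η * ‖z' - m₂‖ := norm_sub_le_of_segment hR hU hη hm₂R hz' hzm₂'
  have l1 : ‖m₁ - z‖ ≤ 4 * R := (norm_sub_le _ _).trans (by rw [hm₁]; linarith)
  have l2 : ‖m₂ - m₁‖ ≤ 4 * R := (norm_sub_le _ _).trans (by rw [hm₁, hm₂]; linarith)
  have l3 : ‖z' - m₂‖ ≤ 4 * R := (norm_sub_le _ _).trans (by rw [hm₂]; linarith)
  have e : U z - U z' = -((U z' - U m₂) + (U m₂ - U m₁) + (U m₁ - U z)) := by abel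
  calc ‖U z - U z'‖ = ‖(U z' - U m₂) + (U m₂ - U m₁) + (U m₁ - U z)‖ := by rw [e, norm_neg]
    _ ≤ ‖U z' - U m₂‖ + ‖U m₂ - U m₁‖ + ‖U m₁ - U z‖ := norm_add₃_le
    _ ≤ η * (4 * R) + η * (4 * R) + η * (4 * R) :=
        add_le_add (add_le_add (s3.trans (mul_le_mul_of_nonneg_left l3 hη0))
          (s2.trans (mul_le_mul_of_nonneg_left l2 hη0))) (s1.trans (mul_le_mul_of_nonneg_left l1 hη0))
    _ = 12 * R * η := by ring

end Shell

end Summit.NavierStokesRegularity.NavierStokesRegularity.Theorems.CoriolisHead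

end
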